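import Summits.QuantumFields.YangMills.Theorems.BalabanUVNodesN20InterpolatedClassFreeEnergy
import Summits.QuantumFields.YangMills.Theorems.BalabanUVNodesN19AffinityClassIndexLaws

/-!
# BalabanUVNodes ∕ node N20 (NE7b) — THE VARIANCE CURRENCY OF THE HELLINGER ROAD IS TWO-SIDED WITH DIFFERENT POWERS, AND ITS s-UNIFORMITY (resp. the
# edition-2 «regime») CANNOT BE DROPPED: (i) a variance FLOOR `v ≤ Var_{μ_s}(h)` on `[0,1]` gives `v∕8 ≤ Δ` and `1 − affinity ≥ min(v∕8,1)∕2`, so an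
# UNSUMMABLE floor at the key kills `HybridNE7` for every choice of the six dials (necessity, via dag-n19-w2 ⇐ p607565); (ii) a two-point WITNESS whose two
# ENDPOINT (one-run) variances tend to `0` while the defect tends to `∞` — the interior of the interpolation, equivalently edition 2's bootstrap regime, carries content

Cell `pub-ymgap` (HUMAN RULING D-0062 Track A ∕ director-ym R399 (3a) second-wave width seats), WIDTH SEAT `pub-ymgap-dag-n20-w4` (node n20 = NE7b),
generation g2, CLAIM-3 ∕ INTENT-3.  Key item K3⁷ `SpineGivenEndpointR13SepCoPH` (stmt-QuantumFields-20544; skeleton of record v5 941dddb108cbaacf, stub 2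
`stub_expansion13H`); filed `--kind proof --supports … --as helper`.  COUNT-NEUTRAL.  THEOREMS ONLY (0 `def`, 0 `instance`, 0 `sorry`).  ADDITIVE — imports this
lineage's FILE 1 `…N20InterpolatedClassFreeEnergy` (p611539: `taylorTwo_le_of_le_deriv2`, `hasDerivAt_log_interpolatedSum`, `hasDerivAt_interpolatedMean`,
`midpointDefect_classFreeEnergy_le`) and dag-n19-w2 g5's `…N19AffinityClassIndexLaws` (p612301: `half_min_le_one_sub_exp_neg`, `summable_of_summable_min_one`,
`not_exists_hybridNE7_of_unsummable_affinityDefect` ⇐ this lineage's p607565) — CITED BY NAME; modifies nothing.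

WHY.  CRIT-1's triage of idea-3's `hellinger-free-energy-road` (06:42Z) raised two precision points this lineage can settle in the kernel: §2 «necessity gives
`Σ H_K² < ∞`, sufficiency needs `Σ H_K < ∞` … powers 2 vs 1», and §5 «`μ_{s,t}` is a TWO-RUN interpolated ensemble … price (V) as two-run unless the line
shows the s-uniform expansion follows from the two one-run expansions».  The card's EDITION 2 (07:18Z) answers §5 by moving the load-bearing supply to one-run
laws under a BOOTSTRAP hypothesis (Sketch ed.2 §10 `mixture_moment_le_of_regime`: in the regime `1 − bc ≤ 1∕16` the mixture second moment of the centred increment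
is `≤ Var_p(h) + Var_q(h)`) and demotes the interpolated ensemble to an optional sharpening.  This file records, as theorems:
* §1 [folklore] THE LOWER SIDE OF FILE 1's CALCULUS: `le_midpointDefect_of_deriv2` (`L ≤ f″` on `[0,1]` ⇒ `L∕8 ≤ (f0 + f1)∕2 − f(½)`);
  ★ `var_div_eight_le_midpointDefect_classFreeEnergy` (a tilted-variance FLOOR `v` on `[0,1]`, the card's hV shape reversed ⇒ `v∕8 ≤ (log ΣA + log ΣB)∕2 − log Σ√(AB)`);
  ★ `half_min_var_le_one_sub_affinity` (⇒ `min(v∕8, 1)∕2 ≤ 1 − Σ_T √((A∕ΣA)(B∕ΣB))`, the affinity being `e^{−Δ} ≤ e^{−v∕8}`).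
* §2 ★★ `not_exists_hybridNE7_of_unsummable_varianceFloor` — NECESSITY IN THE VARIANCE CURRENCY: if at every `K` some admissible `t_K` carries a floor `v_K ≥ 0`
  of the tilted variance uniformly in `s ∈ [0,1]` and `Σ_K v_K = ∞`, then NO `Bad, W, shA, shB, Wsh, δ` give `HybridNE7 l₀ vol T A B …` (dag-n19-w2's affinity-defect
  necessity BY NAME with `g_K := min(v_K∕8,1)∕2`).  With FILE 2's sufficiency (`Σ_K √(sup_{s,t} Var) < ∞`) this is CRIT-1 §2's gap in ONE currency: power ½ of the
  variance CEILING suffices, power 1 of the variance FLOOR (capped at 8) is necessary.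
* §3 ★★ `exists_endpointVar_le_and_le_midpointDefect` — THE ENDPOINT WITNESS: for every `ε > 0`, `D` there are positive two-point class weights `A = (a,1)`, `B = (b,1)`
  (`a = 1∕y`, `b = y`, `y` large) with BOTH endpoint variances `Var_A(h), Var_B(h) ≤ ε` (run-A's is the card's hV at `s = 0` = dag-n19-w4's `varianceLetter_at_zero`
  docking; run-B's is hV at `s = 1`) and defect `≥ D` (so affinity `≤ e^{−D}`, class laws TV-far); ★ `exists_endpointVar_le_and_not_uniformVar` — hence, by FILE 1's
  `midpointDefect_classFreeEnergy_le` read contrapositively, the card's s-UNIFORM hypothesis `∀ s ∈ [0,1], Var_{μ_s}(h) ≤ V` FAILS while both endpoint letters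
  hold with `ε`: the one-run (endpoint) second moments do NOT control the two-run comparison without an a-priori closeness hypothesis — located support for
  CRIT-1 §5's pricing and a TIGHTNESS witness for edition 2's regime hypothesis `1 − bc ≤ 1∕16` in `mixture_moment_le_of_regime` (in the witness `1 − bc → 1`
  and `Σ½(p+q)(h − c)² = log²y` while `Var_p + Var_q ≤ 8 log²y∕y`).  (v1.1: docstring erratum `2·log²y → log²y`; no declaration changed.)

ADJACENT (cited, not re-typed): dag-n19-w4 g4 p611654 `…N19ClassMeanResponseCalculus` (t-calculus, (R)); dag-n19-w4 g5 CLAIM-1 `…N19VarianceOfAnalyticTilt`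
(edition 2's first lemma: one-run analytic tilt ⇒ variance — a one-run SUPPLY lemma; disjoint: no interpolation, no witness); dag-n19-w2 g5 p612301 (Le Cam ∕
affinity ∕ necessity in affinity currency — CONSUMED by name in §2); dag-n20-w1 g5 (caricature files); this lineage's p607565 ∕ p609004 ∕ p611539 ∕ p612607.

HONEST FRAMING.  [folklore] one-variable real analysis on finite sums + one explicit two-point family; the floor `v`, the ceiling `V` and the letters (V)∕(R) are
HYPOTHESIS SHAPES — unproved, NOT PRINTED for d = 4, produced by nobody; the witness is a TOY on two classes, NOT a statement about Bałaban's class weights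
(whether the record's runs sit in edition 2's regime is exactly the physics nobody has); NO estimate of the programme is proved; nothing of Bałaban's asserted or
instantiated; NE7 ∕ NE7b ∕ NE7c NOT PRINTED as two-run statements for d = 4 and NOT proved; N19 ∕ N20 ∕ N21 NOT discharged; K3⁷ OPEN, v5 STANDS, not claimed; no
summit statement is proved by this seat; counts UNMOVED (typed 28∕28 · discharged 5∕28).  One finite four-torus programme at fixed ε — NOT ℝ⁴, NOT infinite volume,
NOT OS, NOT a mass gap, NOT the Clay problem (R4 closes the conditional finite-𝕋⁴ rung `BalabanLadder.UV` only).  0 `def`; 0 `sorry`; standard axioms; no cite tags.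
-/

noncomputable section

namespace Summit.QuantumFields.YangMills.BalabanUVNodes.N20VarianceCurrencyTwoSided

open Finset Set Filter
open Literature.MathematicalPhysics.QuantumFieldTheory.Balaban1983to89
open T4MatchingAssembly (HybridNE7)
open Summit.QuantumFields.YangMills.BalabanUVNodes.N20InterpolatedClassFreeEnergy
  (taylorTwo_le_of_le_deriv2 hasDerivAt_log_interpolatedSum hasDerivAt_interpolatedMean
   sum_mul_exp_zero_mul sum_mul_exp_one_mul sum_mul_exp_half_mul midpointDefect_classFreeEnergy_le)
open Summit.QuantumFields.YangMills.BalabanUVNodes.N19AffinityClassIndexLaws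
  (half_min_le_one_sub_exp_neg summable_of_summable_min_one not_exists_hybridNE7_of_unsummable_affinityDefect)

variable {ι : Type*}

/-! ## §1 The lower side of the calculus: a variance FLOOR bounds the defect from below [folklore] -/

/-- **MIDPOINT DEFECT ≥ L∕8** [folklore]: `L ≤ f″` on `[0,1]` ⇒ `L∕8 ≤ (f 0 + f 1)∕2 − f(½)` (FILE 1's lower Taylor bound from `x = ½`). -/
theorem le_midpointDefect_of_le_deriv2 {f f' f'' : ℝ → ℝ} {L : ℝ}
    (hf : ∀ s, HasDerivAt f (f' s) s) (hf' : ∀ s, HasDerivAt f' (f'' s) s)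
    (hL : ∀ s ∈ Icc (0:ℝ) 1, L ≤ f'' s) :
    L / 8 ≤ (f 0 + f 1) / 2 - f (1 / 2) := by
  have hh : (1/2 : ℝ) ∈ Icc (0:ℝ) 1 := ⟨by norm_num, by norm_num⟩
  have h0 := taylorTwo_le_of_le_deriv2 hf hf' hL hh (left_mem_Icc.2 zero_le_one)
  have h1 := taylorTwo_le_of_le_deriv2 hf hf' hL hh (right_mem_Icc.2 zero_le_one)
  nlinarith [h0, h1]

section ClassWeights
variable {T : Finset ι} {A B : ι → ℝ}

/-- **★ A VARIANCE FLOOR BOUNDS THE DEFECT FROM BELOW** [folklore].  Positive class weights on `T ≠ ∅`, `h = log B − log A`: if the tilted variance is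
bounded BELOW on the unit interval, `∀ s ∈ [0,1], v ≤ Var_{μ_s}(h)` (the card's hV shape, reversed), then `v∕8 ≤ (log ΣA + log ΣB)∕2 − log Σ√(A·B)` — the
same functional as FILE 1's `midpointDefect_classFreeEnergy_le`, from below (CRIT-1 §2 «powers 2 vs 1» made two-sided at one `(K,t)`). -/
theorem var_div_eight_le_midpointDefect_classFreeEnergy (hT : T.Nonempty) (hA : ∀ τ ∈ T, 0 < A τ) (hB : ∀ τ ∈ T, 0 < B τ) {v : ℝ}
    (hv : ∀ s ∈ Set.Icc (0:ℝ) 1, v ≤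
      (∑ τ ∈ T, A τ * Real.exp (s * (Real.log (B τ) - Real.log (A τ))) * (Real.log (B τ) - Real.log (A τ)) ^ 2)
          / (∑ τ ∈ T, A τ * Real.exp (s * (Real.log (B τ) - Real.log (A τ))))
        - ((∑ τ ∈ T, A τ * Real.exp (s * (Real.log (B τ) - Real.log (A τ))) * (Real.log (B τ) - Real.log (A τ)))
          / (∑ τ ∈ T, A τ * Real.exp (s * (Real.log (B τ) - Real.log (A τ))))) ^ 2) :
    v / 8 ≤ (Real.log (∑ τ ∈ T, A τ) + Real.log (∑ τ ∈ T, B τ)) / 2 - Real.log (∑ τ ∈ T, Real.sqrt (A τ * B τ)) := by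
  have h := le_midpointDefect_of_le_deriv2
    (hasDerivAt_log_interpolatedSum (fun τ => Real.log (B τ) - Real.log (A τ)) hT hA)
    (hasDerivAt_interpolatedMean (fun τ => Real.log (B τ) - Real.log (A τ)) hT hA) hv
  rwa [sum_mul_exp_zero_mul, sum_mul_exp_one_mul hA hB, sum_mul_exp_half_mul hA hB] at h

/-- [folklore; private] the Hellinger affinity of the normalised class laws is `e^{−Δ}`. -/
private theorem affinity_normalised_eq_exp_neg (hT : T.Nonempty) (hA : ∀ τ ∈ T, 0 < A τ) (hB : ∀ τ ∈ T, 0 < B τ) :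
    ∑ τ ∈ T, Real.sqrt (A τ / (∑ σ ∈ T, A σ) * (B τ / ∑ σ ∈ T, B σ))
      = Real.exp (-((Real.log (∑ τ ∈ T, A τ) + Real.log (∑ τ ∈ T, B τ)) / 2 - Real.log (∑ τ ∈ T, Real.sqrt (A τ * B τ)))) := by
  have hZA : 0 < ∑ τ ∈ T, A τ := sum_pos hA hT
  have hZB : 0 < ∑ τ ∈ T, B τ := sum_pos hB hT
  have hbc : 0 < ∑ τ ∈ T, Real.sqrt (A τ * B τ) := sum_pos (fun τ hτ => Real.sqrt_pos.2 (mul_pos (hA τ hτ) (hB τ hτ))) hT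
  have hE : Real.exp ((Real.log (∑ τ ∈ T, A τ) + Real.log (∑ τ ∈ T, B τ)) / 2) = Real.sqrt ((∑ τ ∈ T, A τ) * ∑ τ ∈ T, B τ) := by
    symm
    rw [Real.sqrt_eq_iff_mul_self_eq (mul_pos hZA hZB).le (Real.exp_pos _).le, ← Real.exp_add, add_halves, Real.exp_add,
      Real.exp_log hZA, Real.exp_log hZB]
  rw [neg_sub, Real.exp_sub, Real.exp_log hbc, hE, Finset.sum_div]
  refine sum_congr rfl fun τ hτ => ?_
  rw [div_mul_div_comm, Real.sqrt_div' _ (mul_pos hZA hZB).le]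

/-- **★ A VARIANCE FLOOR CAPS THE AFFINITY**: same hypotheses ⇒ `Σ_T √((A∕ΣA)(B∕ΣB)) ≤ e^{−v∕8}` and hence `min(v∕8, 1)∕2 ≤ 1 − Σ_T √((A∕ΣA)(B∕ΣB))`
(the affinity is `e^{−Δ}`; `min(x,1)∕2 ≤ 1 − e^{−x}` is dag-n19-w2's `half_min_le_one_sub_exp_neg`). [folklore] -/
theorem half_min_var_le_one_sub_affinity (hT : T.Nonempty) (hA : ∀ τ ∈ T, 0 < A τ) (hB : ∀ τ ∈ T, 0 < B τ) {v : ℝ} (hv0 : 0 ≤ v)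
    (hv : ∀ s ∈ Set.Icc (0:ℝ) 1, v ≤
      (∑ τ ∈ T, A τ * Real.exp (s * (Real.log (B τ) - Real.log (A τ))) * (Real.log (B τ) - Real.log (A τ)) ^ 2)
          / (∑ τ ∈ T, A τ * Real.exp (s * (Real.log (B τ) - Real.log (A τ))))
        - ((∑ τ ∈ T, A τ * Real.exp (s * (Real.log (B τ) - Real.log (A τ))) * (Real.log (B τ) - Real.log (A τ)))
          / (∑ τ ∈ T, A τ * Real.exp (s * (Real.log (B τ) - Real.log (A τ))))) ^ 2) :
    min (v / 8) 1 / 2 ≤ 1 - ∑ τ ∈ T, Real.sqrt (A τ / (∑ σ ∈ T, A σ) * (B τ / ∑ σ ∈ T, B σ)) := by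
  have hΔ := var_div_eight_le_midpointDefect_classFreeEnergy hT hA hB hv
  have h1 := half_min_le_one_sub_exp_neg (x := v / 8) (by linarith)
  rw [affinity_normalised_eq_exp_neg hT hA hB]
  have h2 : Real.exp (-((Real.log (∑ τ ∈ T, A τ) + Real.log (∑ τ ∈ T, B τ)) / 2 - Real.log (∑ τ ∈ T, Real.sqrt (A τ * B τ))))
      ≤ Real.exp (-(v / 8)) := Real.exp_le_exp.2 (by linarith)
  linarith

end ClassWeights

/-! ## §2 Along `K`: an unsummable variance FLOOR at the key kills the hybrid for every choice of the six dials [folklore] -/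

section AlongK
variable [DecidableEq ι] {l₀ vol : ℝ} {T : ℕ → Finset ι} {A B : ℕ → ℝ → ι → ℝ}

/-- **★★ NECESSITY IN THE VARIANCE CURRENCY** [folklore].  If at every level `K` there is an admissible source value `t_K` (`|t_K| ≤ l₀`, positive class
weights on `T K ≠ ∅`) at which the tilted variance of the two-run log-increment is bounded BELOW by `v K ≥ 0` uniformly in `s ∈ [0,1]`, and `Σ_K v K = ∞`, then
NO choice of the six dials `Bad, W, shA, shB, Wsh, δ` gives `HybridNE7 l₀ vol T A B …` — the affinity defect is `≥ min(v∕8, 1)∕2`, unsummable, and dag-n19-w2's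
`not_exists_hybridNE7_of_unsummable_affinityDefect` (⇐ this lineage's p607565) applies BY NAME.  Two-sided picture with FILE 2: sufficiency needs
`Σ_K √(sup_{s,t} Var) < ∞`, necessity gives `Σ_K min(inf_s Var, 8) < ∞` at any admissible selection (powers 1 vs 2 of the same functional; CRIT-1 §2). -/
theorem not_exists_hybridNE7_of_unsummable_varianceFloor {v : ℕ → ℝ} (hv0 : ∀ K, 0 ≤ v K) (hvs : ¬ Summable v)
    (hfloor : ∀ K : ℕ, ∃ t : ℝ, |t| ≤ l₀ ∧ (T K).Nonempty ∧ (∀ τ ∈ T K, 0 < A K t τ) ∧ (∀ τ ∈ T K, 0 < B K t τ) ∧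
      ∀ s ∈ Set.Icc (0:ℝ) 1, v K ≤
        (∑ τ ∈ T K, A K t τ * Real.exp (s * (Real.log (B K t τ) - Real.log (A K t τ))) * (Real.log (B K t τ) - Real.log (A K t τ)) ^ 2)
            / (∑ τ ∈ T K, A K t τ * Real.exp (s * (Real.log (B K t τ) - Real.log (A K t τ))))
          - ((∑ τ ∈ T K, A K t τ * Real.exp (s * (Real.log (B K t τ) - Real.log (A K t τ))) * (Real.log (B K t τ) - Real.log (A K t τ)))
            / (∑ τ ∈ T K, A K t τ * Real.exp (s * (Real.log (B K t τ) - Real.log (A K t τ))))) ^ 2) :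
    ¬ ∃ (Bad : ℕ → ℝ → Finset ι) (W : ℕ → ℝ) (shA shB : ℕ → ℝ → ι → ℝ) (Wsh δ : ℕ → ℝ),
      HybridNE7 l₀ vol T A B Bad W shA shB Wsh δ := by
  -- the capped floor `min(v/8, 1)/2` is nonnegative and unsummable
  have hg0 : ∀ K, 0 ≤ min (v K / 8) 1 / 2 := fun K => by
    have := hv0 K; positivity
  have hgs : ¬ Summable fun K => min (v K / 8) 1 / 2 := by
    intro h
    have h1 : Summable fun K => min (v K / 8) 1 := (h.mul_left 2).congr fun K => by ring
    have h2 : Summable fun K => v K / 8 := summable_of_summable_min_one h1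
    exact hvs ((h2.mul_left 8).congr fun K => by ring)
  refine not_exists_hybridNE7_of_unsummable_affinityDefect hg0 hgs fun K => ?_
  obtain ⟨t, ht, hT, hA, hB, hv⟩ := hfloor K
  exact ⟨t, ht, fun τ hτ => (hA τ hτ).le, fun τ hτ => (hB τ hτ).le, sum_pos hA hT, sum_pos hB hT,
    half_min_var_le_one_sub_affinity hT hA hB (hv0 K) hv⟩

end AlongK

/-! ## §3 The endpoints do NOT control the interior: a two-point witness [folklore] -/

section Witness

/-- [arithmetic; private] sums over the two-point class set. -/
private theorem sum_bool (f : Bool → ℝ) : ∑ v ∈ (Finset.univ : Finset Bool), f v = f true + f false := Fintype.sum_bool f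

/-- **★★ ENDPOINT VARIANCES DO NOT CONTROL THE DEFECT** [folklore; located witness for CRIT-1's §5 on the card's letter (V)].  For every `ε > 0` and every `D`
there are positive two-point class weights `A = (a, 1)`, `B = (b, 1)` on `T = {true, false}` (`bif v then a else 1`, …) whose two ENDPOINT variances of the
log-increment `h = log B − log A` — run-A's `Var_A(h)` (the card's hV at `s = 0`; dag-n19-w4's `varianceLetter_at_zero`) and run-B's `Var_B(h)` (hV at `s = 1`) —
are both `≤ ε`, while the midpoint defect `(log ΣA + log ΣB)∕2 − log Σ√(A·B)` is `≥ D`.  Witness: `a = 1∕y`, `b = y`, `y → ∞` (both variances `= 4 log²y · y∕(1+y)²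
≤ 4 log²y ∕ y`, defect `≥ ½ log y − log 2`).  Hence the road's s-UNIFORM variance letter is NOT implied by one-run-type (endpoint) second moments. -/
theorem exists_endpointVar_le_and_le_midpointDefect (ε D : ℝ) (hε : 0 < ε) :
    ∃ a b : ℝ, 0 < a ∧ 0 < b ∧
      (∑ v ∈ (Finset.univ : Finset Bool), (bif v then a else 1) * (Real.log (bif v then b else 1) - Real.log (bif v then a else 1)) ^ 2)
          / (∑ v ∈ (Finset.univ : Finset Bool), (bif v then a else 1))
        - ((∑ v ∈ (Finset.univ : Finset Bool), (bif v then a else 1) * (Real.log (bif v then b else 1) - Real.log (bif v then a else 1)))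
          / (∑ v ∈ (Finset.univ : Finset Bool), (bif v then a else 1))) ^ 2 ≤ ε ∧
      (∑ v ∈ (Finset.univ : Finset Bool), (bif v then b else 1) * (Real.log (bif v then b else 1) - Real.log (bif v then a else 1)) ^ 2)
          / (∑ v ∈ (Finset.univ : Finset Bool), (bif v then b else 1))
        - ((∑ v ∈ (Finset.univ : Finset Bool), (bif v then b else 1) * (Real.log (bif v then b else 1) - Real.log (bif v then a else 1)))
          / (∑ v ∈ (Finset.univ : Finset Bool), (bif v then b else 1))) ^ 2 ≤ ε ∧
      D ≤ (Real.log (∑ v ∈ (Finset.univ : Finset Bool), (bif v then a else 1))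
            + Real.log (∑ v ∈ (Finset.univ : Finset Bool), (bif v then b else 1))) / 2
          - Real.log (∑ v ∈ (Finset.univ : Finset Bool), Real.sqrt ((bif v then a else 1) * (bif v then b else 1))) := by
  -- choose `y` large: `log² y / y ≤ ε / 4`, `2D + 2 log 2 ≤ log y`, `y ≥ 1`
  have h1 : ∀ᶠ y : ℝ in atTop, Real.log y ^ 2 / (1 * y + 0) ≤ ε / 4 :=
    (Real.tendsto_pow_log_div_mul_add_atTop 1 0 2 one_ne_zero).eventually (eventually_le_nhds (by linarith))
  have h2 : ∀ᶠ y : ℝ in atTop, 2 * D + 2 * Real.log 2 ≤ Real.log y := Real.tendsto_log_atTop.eventually (eventually_ge_atTop _)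
  have h3 : ∀ᶠ y : ℝ in atTop, (1:ℝ) ≤ y := eventually_ge_atTop 1
  obtain ⟨y, hy1, hy2, hy3⟩ := (h1.and (h2.and h3)).exists
  have hy0 : 0 < y := by linarith
  rw [show (1:ℝ) * y + 0 = y by ring] at hy1
  set L := Real.log y with hL
  have hLa : Real.log y - Real.log (1 / y) = 2 * L := by rw [one_div, Real.log_inv]; ring
  -- the seven two-point sums
  have sA0 : ∑ v ∈ (Finset.univ : Finset Bool), (bif v then 1 / y else 1) = 1 / y + 1 := by rw [sum_bool]; rfl
  have sB0 : ∑ v ∈ (Finset.univ : Finset Bool), (bif v then y else 1) = y + 1 := by rw [sum_bool]; rfl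
  have sA1 : ∑ v ∈ (Finset.univ : Finset Bool), (bif v then 1 / y else 1) * (Real.log (bif v then y else 1) - Real.log (bif v then 1 / y else 1))
      = 1 / y * (2 * L) := by
    rw [sum_bool]; simp only [cond_true, cond_false, Real.log_one, sub_self, mul_zero, add_zero, hLa]
  have sA2 : ∑ v ∈ (Finset.univ : Finset Bool), (bif v then 1 / y else 1) * (Real.log (bif v then y else 1) - Real.log (bif v then 1 / y else 1)) ^ 2
      = 1 / y * (2 * L) ^ 2 := by
    rw [sum_bool]; simp only [cond_true, cond_false, Real.log_one, sub_self, mul_zero, add_zero, hLa, zero_pow two_ne_zero]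
  have sB1 : ∑ v ∈ (Finset.univ : Finset Bool), (bif v then y else 1) * (Real.log (bif v then y else 1) - Real.log (bif v then 1 / y else 1))
      = y * (2 * L) := by
    rw [sum_bool]; simp only [cond_true, cond_false, Real.log_one, sub_self, mul_zero, add_zero, hLa]
  have sB2 : ∑ v ∈ (Finset.univ : Finset Bool), (bif v then y else 1) * (Real.log (bif v then y else 1) - Real.log (bif v then 1 / y else 1)) ^ 2
      = y * (2 * L) ^ 2 := by
    rw [sum_bool]; simp only [cond_true, cond_false, Real.log_one, sub_self, mul_zero, add_zero, hLa, zero_pow two_ne_zero]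
  have sAB : ∑ v ∈ (Finset.univ : Finset Bool), Real.sqrt ((bif v then 1 / y else 1) * (bif v then y else 1)) = 2 := by
    rw [sum_bool]; simp only [cond_true, cond_false, mul_one, Real.sqrt_one]
    rw [one_div, inv_mul_cancel₀ hy0.ne', Real.sqrt_one]; norm_num
  have hfrac : y / (1 + y) ^ 2 ≤ 1 / y := by
    rw [div_le_div_iff₀ (by positivity) hy0]
    nlinarith
  have hvar : 4 * L ^ 2 * (y / (1 + y) ^ 2) ≤ ε :=
    calc 4 * L ^ 2 * (y / (1 + y) ^ 2) ≤ 4 * L ^ 2 * (1 / y) := mul_le_mul_of_nonneg_left hfrac (by positivity)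
      _ = 4 * (L ^ 2 / y) := by ring
      _ ≤ ε := by linarith
  refine ⟨1 / y, y, by positivity, hy0, ?_, ?_, ?_⟩
  · rw [sA2, sA1, sA0]
    have key : 1 / y * (2 * L) ^ 2 / (1 / y + 1) - (1 / y * (2 * L) / (1 / y + 1)) ^ 2 = 4 * L ^ 2 * (y / (1 + y) ^ 2) := by
      field_simp
      ring
    rw [key]; exact hvar
  · rw [sB2, sB1, sB0]
    have key : y * (2 * L) ^ 2 / (y + 1) - (y * (2 * L) / (y + 1)) ^ 2 = 4 * L ^ 2 * (y / (1 + y) ^ 2) := by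
      field_simp
      ring
    rw [key]; exact hvar
  · rw [sA0, sB0, sAB]
    have hA : 0 ≤ Real.log (1 / y + 1) := Real.log_nonneg (by rw [le_add_iff_nonneg_left]; positivity)
    have hB : L ≤ Real.log (y + 1) := by rw [hL]; exact Real.log_le_log hy0 (by linarith)
    linarith

/-- **COROLLARY: THE s-UNIFORM LETTER FAILS WHILE BOTH ENDPOINT LETTERS HOLD** [folklore].  With the witness above and FILE 1's
`midpointDefect_classFreeEnergy_le` read contrapositively: for every `ε > 0` and every `V` there are positive two-point weights whose two endpoint variances are
`≤ ε` but for which the card's hypothesis `∀ s ∈ [0,1], Var_{μ_s}(h) ≤ V` is FALSE (witness with `D := V∕8 + 1`).  The interior of the interpolation carries content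
that no one-run (endpoint) second moment sees. -/
theorem exists_endpointVar_le_and_not_uniformVar (ε V : ℝ) (hε : 0 < ε) :
    ∃ a b : ℝ, 0 < a ∧ 0 < b ∧
      (∑ v ∈ (Finset.univ : Finset Bool), (bif v then a else 1) * (Real.log (bif v then b else 1) - Real.log (bif v then a else 1)) ^ 2)
          / (∑ v ∈ (Finset.univ : Finset Bool), (bif v then a else 1))
        - ((∑ v ∈ (Finset.univ : Finset Bool), (bif v then a else 1) * (Real.log (bif v then b else 1) - Real.log (bif v then a else 1)))
          / (∑ v ∈ (Finset.univ : Finset Bool), (bif v then a else 1))) ^ 2 ≤ ε ∧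
      (∑ v ∈ (Finset.univ : Finset Bool), (bif v then b else 1) * (Real.log (bif v then b else 1) - Real.log (bif v then a else 1)) ^ 2)
          / (∑ v ∈ (Finset.univ : Finset Bool), (bif v then b else 1))
        - ((∑ v ∈ (Finset.univ : Finset Bool), (bif v then b else 1) * (Real.log (bif v then b else 1) - Real.log (bif v then a else 1)))
          / (∑ v ∈ (Finset.univ : Finset Bool), (bif v then b else 1))) ^ 2 ≤ ε ∧
      ¬ ∀ s ∈ Set.Icc (0:ℝ) 1,
        (∑ v ∈ (Finset.univ : Finset Bool), (bif v then a else 1) * Real.exp (s * (Real.log (bif v then b else 1) - Real.log (bif v then a else 1)))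
              * (Real.log (bif v then b else 1) - Real.log (bif v then a else 1)) ^ 2)
            / (∑ v ∈ (Finset.univ : Finset Bool), (bif v then a else 1) * Real.exp (s * (Real.log (bif v then b else 1) - Real.log (bif v then a else 1))))
          - ((∑ v ∈ (Finset.univ : Finset Bool), (bif v then a else 1) * Real.exp (s * (Real.log (bif v then b else 1) - Real.log (bif v then a else 1)))
              * (Real.log (bif v then b else 1) - Real.log (bif v then a else 1)))
            / (∑ v ∈ (Finset.univ : Finset Bool), (bif v then a else 1) * Real.exp (s * (Real.log (bif v then b else 1) - Real.log (bif v then a else 1))))) ^ 2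
          ≤ V := by
  obtain ⟨a, b, ha, hb, hVA, hVB, hD⟩ := exists_endpointVar_le_and_le_midpointDefect ε (V / 8 + 1) hε
  refine ⟨a, b, ha, hb, hVA, hVB, fun hV => ?_⟩
  have h := midpointDefect_classFreeEnergy_le (T := (Finset.univ : Finset Bool)) (A := fun v => bif v then a else 1)
    (B := fun v => bif v then b else 1) ⟨true, mem_univ _⟩
    (fun v _ => by cases v <;> simp only [cond_true, cond_false] <;> positivity)
    (fun v _ => by cases v <;> simp only [cond_true, cond_false] <;> positivity) hV
  linarith

end Witness

end Summit.QuantumFields.YangMills.BalabanUVNodes.N20VarianceCurrencyTwoSided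

end
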